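import Summits.ValiantsHypothesis.ValiantsHypothesis.Theorems.SymPencilPerFourPeeledTenGeneric
import Summits.ValiantsHypothesis.ValiantsHypothesis.Theorems.SymPencilPerFourPeeledPad
import Summits.ValiantsHypothesis.ValiantsHypothesis.Theorems.SymPencilPerFourPeeledResidualB
import Summits.ValiantsHypothesis.ValiantsHypothesis.Theorems.SymPencilPerFourPeeledResidualC

/-!
# Route `SymPencil` — inner rank of the `2 | 2` row split of `per_4`: NO PEELED REDUCED FAMILY WITH
# AT MOST TEN SQUARES (`--supports` stmt-ValiantsHypothesis-5674 `SdcSuperquadratic`; (8,8) column,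
# memo `NOTE-p6g16-5674-R2-peeled-ten.md`)

**Theorem** (`false_of_peeled_le_ten`).  There is no reduced family (`…InnerRankReducedFamily.
exists_reduced_family`: non-zero weights `c`, joint identity, scalar outer blocks `v₀, v₀'`) with
`|κ| ≤ 10` whose correction `Σ c t((a,0),(y,0)) t((0,b),(0,z))` is not identically zero.
Assembly: pad to `|κ| = 10` (`…PeeledPad`); read off the row-`𝟙` coefficients `h` of the `a`-block;
case tree on `h` — a good triple (`…PeeledTenGeneric`), the zero vector (a fixed Case-A witness), or a
residual pattern (`…PeeledResidual{,B,C}` after a coordinate permutation `…PeeledTransport` and a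
rescaling of `v₀`) — each ending in `…PeeledTenCaseA.false_of_peeled_ten_of_witness` (Lagrangian
confinement + flattening-rank lemma F5).

Together with the pure case P1 (`…InnerRankPureGramP1`, landed) and the composition
`…InnerRankOfPeeled.IR_of_peeled`, this is the last input of cell (8,8,10) of the size-27 table;
the one-line discharge of that file's hypothesis `HR2` at `d = 10` lives in `…PeeledTenHR2`.
Honest framing: the peeled case at ELEVEN squares (cell (8,8,11)) is untouched; the crux
stmt-5674, `sdc(per_4)` beyond the (8,8,10) cell, and `VP ≠ VNP` are untouched.  No definitions,
no named facts. [folklore]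
-/

noncomputable section

-- single-conjunct layout: Sub = Summit, duplicated namespace component intended
set_option linter.dupNamespace false

namespace Summit.ValiantsHypothesis.ValiantsHypothesis.Theorems.SymPencilPerFourPeeledTen

open Matrix Finset
open Summit.ValiantsHypothesis.ValiantsHypothesis.Theorems.SymPencilPerFourPeeledHessian
open Summit.ValiantsHypothesis.ValiantsHypothesis.Theorems.SymPencilPerFourPeeledTenCaseA
open Summit.ValiantsHypothesis.ValiantsHypothesis.Theorems.SymPencilPerFourPeeledTransport
open Summit.ValiantsHypothesis.ValiantsHypothesis.Theorems.SymPencilPerFourPeeledTenGeneric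
open Summit.ValiantsHypothesis.ValiantsHypothesis.Theorems.SymPencilPerFourPeeledPad
open Summit.ValiantsHypothesis.ValiantsHypothesis.Theorems.SymPencilPerFourPeeledResidual
open Summit.ValiantsHypothesis.ValiantsHypothesis.Theorems.SymPencilPerFourPeeledResidualB
open Summit.ValiantsHypothesis.ValiantsHypothesis.Theorems.SymPencilPerFourPeeledResidualC

universe u v

variable {K : Type u} [Field K]

/-- **Witness after a coordinate permutation and a rescaling.**  If, for a permutation `π` and a
scalar `d ≠ 0`, the vector `k ↦ h(π⁻¹ k)/d` admits pencil witnesses `y₀, y₁` (output shape of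
`htz_caseA` / `htz_R*`), the peeled reduced family with `|κ| = 10` does not exist. [folklore] -/
theorem false_of_witness_perm_scale [CharZero K] {κ : Type v} [Fintype κ] [DecidableEq κ]
    (hκ : Fintype.card κ = 10) (c : κ → K) (hc : ∀ r, c r ≠ 0)
    (t : κ → (((Fin 4 → K) × (Fin 4 → K)) →ₗ[K] ((Fin 4 → K) × (Fin 4 → K)) →ₗ[K] K))
    (hJ : ∀ a b y₂ y₃ : Fin 4 → K,
      ∑ r, c r * (t r (a, b) (y₂, y₃)) ^ 2 = (Matrix.of ![a, b, y₂, y₃]).permanent)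
    (v₀ v₀' : κ → K) (hv₀ : ∀ (a x : Fin 4 → K), ∃ s : K, (fun r => t r (a, 0) (x, 0)) = s • v₀)
    (hv₀' : ∀ (b x : Fin 4 → K), ∃ s : K, (fun r => t r (0, b) (0, x)) = s • v₀')
    (hpeel : ∃ a b y z : Fin 4 → K, ∑ r, c r * t r (a, 0) (y, 0) * t r (0, b) (0, z) ≠ 0)
    (h : Fin 4 → K) (hh : ∀ k r, t r ((fun _ => 1), 0) (Pi.single k 1, 0) = h k * v₀ r)
    (π : Equiv.Perm (Fin 4)) (d : K) (hd : d ≠ 0) (y₀ y₁ : Fin 4 → K)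
    (hy₀h : ∑ k, y₀ k * (h (π.symm k) / d) = 0) (hy₁h : ∑ k, y₁ k * (h (π.symm k) / d) = 0)
    (hdet : IsUnit (Matrix.of fun b l => (Matrix.of ![(fun _ => (1 : K)), Pi.single b 1, y₀,
      Pi.single l 1]).permanent).det)
    (htz : ∀ A : Matrix (Fin 4) (Fin 4) K, Aᵀ = -A →
      A * ((Matrix.of fun b l => (Matrix.of ![(fun _ => (1 : K)), Pi.single b 1, y₀,
          Pi.single l 1]).permanent)⁻¹ *
        (Matrix.of fun b l => (Matrix.of ![(fun _ => (1 : K)), Pi.single b 1, y₁,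
          Pi.single l 1]).permanent)) =
      ((Matrix.of fun b l => (Matrix.of ![(fun _ => (1 : K)), Pi.single b 1, y₀,
          Pi.single l 1]).permanent)⁻¹ *
        (Matrix.of fun b l => (Matrix.of ![(fun _ => (1 : K)), Pi.single b 1, y₁,
          Pi.single l 1]).permanent))ᵀ * A → A = 0) : False := by
  obtain ⟨t', hJ', hw₀, hw₀', hpeel', hh'⟩ := transport_perm π c t hJ v₀ v₀' hv₀ hv₀' hpeel h hh
  -- rescale `v₀ ↦ d • v₀`
  have hw₀d : ∀ (a x : Fin 4 → K), ∃ s : K, (fun r => t' r (a, 0) (x, 0)) = s • (d • v₀) := by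
    intro a x
    obtain ⟨s, hs⟩ := hw₀ a x
    exact ⟨s / d, by rw [hs, smul_smul, div_mul_cancel₀ _ hd]⟩
  have hhd : ∀ k r, t' r ((fun _ => 1), 0) (Pi.single k 1, 0) = (h (π.symm k) / d) * (d • v₀) r := by
    intro k r
    rw [hh' k r, Pi.smul_apply, smul_eq_mul, div_mul_eq_mul_div, mul_div_assoc, mul_div_cancel_left₀ _ hd]
  exact false_of_peeled_ten_of_witness hκ c hc t' hJ' (d • v₀) v₀' hw₀d hw₀' hpeel'
    (fun k => h (π.symm k) / d) hhd y₀ y₁ hy₀h hy₁h hdet htz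

/-- A permutation of `Fin 4` with prescribed preimages of `0, 1, 2, 3`. [folklore] -/
theorem exists_perm_of_tuple (i j k l : Fin 4) (hij : i ≠ j) (hik : i ≠ k) (hil : i ≠ l)
    (hjk : j ≠ k) (hjl : j ≠ l) (hkl : k ≠ l) :
    ∃ σ : Equiv.Perm (Fin 4), σ.symm 0 = i ∧ σ.symm 1 = j ∧ σ.symm 2 = k ∧ σ.symm 3 = l := by
  let f : Fin 4 → Fin 4 := ![i, j, k, l]
  have hf : Function.Injective f := by
    intro x y hxy
    fin_cases x <;> fin_cases y <;> simp [f] at hxy ⊢ <;> first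
      | rfl | exact absurd hxy hij | exact absurd hxy.symm hij | exact absurd hxy hik
      | exact absurd hxy.symm hik | exact absurd hxy hjk | exact absurd hxy.symm hjk
      | exact absurd hxy.symm hil | exact absurd hxy hil | exact absurd hxy.symm hjl
      | exact absurd hxy hjl | exact absurd hxy.symm hkl | exact absurd hxy hkl
  let σ : Equiv.Perm (Fin 4) := Equiv.ofBijective f (Finite.injective_iff_bijective.1 hf)
  exact ⟨σ.symm, by simp [σ, f], by simp [σ, f], by simp [σ, f], by simp [σ, f]⟩

section leaves

variable [CharZero K] {κ : Type v} [Fintype κ] [DecidableEq κ]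
  (hκ : Fintype.card κ = 10) (c : κ → K) (hc : ∀ r, c r ≠ 0)
  (t : κ → (((Fin 4 → K) × (Fin 4 → K)) →ₗ[K] ((Fin 4 → K) × (Fin 4 → K)) →ₗ[K] K))
  (hJ : ∀ a b y₂ y₃ : Fin 4 → K,
    ∑ r, c r * (t r (a, b) (y₂, y₃)) ^ 2 = (Matrix.of ![a, b, y₂, y₃]).permanent)
  (v₀ v₀' : κ → K) (hv₀ : ∀ (a x : Fin 4 → K), ∃ s : K, (fun r => t r (a, 0) (x, 0)) = s • v₀)
  (hv₀' : ∀ (b x : Fin 4 → K), ∃ s : K, (fun r => t r (0, b) (0, x)) = s • v₀')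
  (hpeel : ∃ a b y z : Fin 4 → K, ∑ r, c r * t r (a, 0) (y, 0) * t r (0, b) (0, z) ≠ 0)
  (h : Fin 4 → K) (hh : ∀ k r, t r ((fun _ => 1), 0) (Pi.single k 1, 0) = h k * v₀ r)
include hκ hc hJ hv₀ hv₀' hpeel hh

/-- Leaf: `h = 0` (then every pair of parameters is orthogonal to `h`; use a fixed Case-A witness).
[folklore] -/
theorem leaf_zero (hz : ∀ k, h k = 0) : False := by
  obtain ⟨hy₀h, hy₁h, hdet, htz⟩ := htz_caseA (K := K) ![1, 2, 3, 0] 1 (by simp) (by simp) (by simp)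
    (by simp) (by simp) (by simp) one_ne_zero (by simp; norm_num) (by simp; norm_num)
    (Matrix.of fun b l => (Matrix.of ![(fun _ => (1 : K)), Pi.single b 1,
      ![(![1, 2, 3, 0] : Fin 4 → K) 1 + 1 * (![1, 2, 3, 0] : Fin 4 → K) 2,
        -(![1, 2, 3, 0] : Fin 4 → K) 0, -(1 * (![1, 2, 3, 0] : Fin 4 → K) 0), 0],
      Pi.single l 1]).permanent)
    (Matrix.of fun b l => (Matrix.of ![(fun _ => (1 : K)), Pi.single b 1,
      ![(![1, 2, 3, 0] : Fin 4 → K) 2, 0, -(![1, 2, 3, 0] : Fin 4 → K) 0, 0],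
      Pi.single l 1]).permanent)
    (fun b l => rfl) (fun b l => rfl)
  refine false_of_witness_perm_scale hκ c hc t hJ v₀ v₀' hv₀ hv₀' hpeel h hh 1 1 one_ne_zero _ _
    ?_ ?_ hdet htz
  · simp [hz]
  · simp [hz]

/-- Leaf: exactly one non-zero coordinate (pattern R1). [folklore] -/
theorem leaf_one (i : Fin 4) (hi : h i ≠ 0) (hz : ∀ k, k ≠ i → h k = 0) : False := by
  let σ : Equiv.Perm (Fin 4) := Equiv.swap 0 i
  have hσ0 : σ.symm 0 = i := by simp [σ]
  have hne : ∀ m : Fin 4, m ≠ 0 → σ.symm m ≠ i := fun m hm e => by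
    have : σ.symm m = σ.symm 0 := e.trans hσ0.symm
    exact hm (σ.symm.injective this)
  obtain ⟨hy₀h, hy₁h, hdet, htz⟩ := htz_R1 (K := K) (fun k => h (σ.symm k) / h i)
    (by simp [hz _ (hne 1 (by decide))]) (by simp [hz _ (hne 2 (by decide))])
    (by simp [hz _ (hne 3 (by decide))]) _ _ (fun b l => rfl) (fun b l => rfl)
  exact false_of_witness_perm_scale hκ c hc t hJ v₀ v₀' hv₀ hv₀' hpeel h hh σ (h i) hi _ _
    hy₀h hy₁h hdet htz

/-- Leaf: exactly two non-zero coordinates `i, j` (patterns R2 / R2m). [folklore] -/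
theorem leaf_two (i j : Fin 4) (hij : i ≠ j) (hi : h i ≠ 0) (hj : h j ≠ 0)
    (hz : ∀ k, k ≠ i → k ≠ j → h k = 0) : False := by
  -- the two remaining indices
  obtain ⟨k, l, hik, hil, hjk, hjl, hkl⟩ : ∃ k l : Fin 4, i ≠ k ∧ i ≠ l ∧ j ≠ k ∧ j ≠ l ∧ k ≠ l := by
    fin_cases i <;> fin_cases j <;> simp at hij ⊢ <;> decide
  obtain ⟨σ, hσ0, hσ1, hσ2, hσ3⟩ := exists_perm_of_tuple i j k l hij hik hil hjk hjl hkl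
  have e2 : h (σ.symm 2) = 0 := by rw [hσ2]; exact hz k hik.symm hjk.symm
  have e3 : h (σ.symm 3) = 0 := by rw [hσ3]; exact hz l hil.symm hjl.symm
  by_cases hm : h j = -h i
  · obtain ⟨hy₀h, hy₁h, hdet, htz⟩ := htz_R2m (K := K) (fun k => h (σ.symm k) / h i)
      (by simp [hσ0, hi]) (by simp [hσ1, hm, hi]) (by simp [e2]) (by simp [e3]) _ _
      (fun b l => rfl) (fun b l => rfl)
    exact false_of_witness_perm_scale hκ c hc t hJ v₀ v₀' hv₀ hv₀' hpeel h hh σ (h i) hi _ _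
      hy₀h hy₁h hdet htz
  · obtain ⟨hy₀h, hy₁h, hdet, htz⟩ := htz_R2 (K := K) (fun k => h (σ.symm k) / h i) (h j / h i)
      (by simp [hσ0, hi]) (by simp [hσ1]) (by simp [e2]) (by simp [e3]) (div_ne_zero hj hi)
      (by
        intro e; apply hm
        have : h j / h i = -1 := by linear_combination e
        rw [div_eq_iff hi] at this; linear_combination this) _ _
      (fun b l => rfl) (fun b l => rfl)
    exact false_of_witness_perm_scale hκ c hc t hJ v₀ v₀' hv₀ hv₀' hpeel h hh σ (h i) hi _ _
      hy₀h hy₁h hdet htz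

/-- Leaf: exactly one zero coordinate `l` and a repeat `h i = h j` among the others (pattern R3).
[folklore] -/
theorem leaf_three (i j k l : Fin 4) (hij : i ≠ j) (hik : i ≠ k) (hil : i ≠ l) (hjk : j ≠ k)
    (hjl : j ≠ l) (hkl : k ≠ l) (hi : h i ≠ 0) (hk : h k ≠ 0) (hl : h l = 0) (heq : h i = h j) :
    False := by
  obtain ⟨σ, hσ0, hσ1, hσ2, hσ3⟩ := exists_perm_of_tuple i j k l hij hik hil hjk hjl hkl
  obtain ⟨hy₀h, hy₁h, hdet, htz⟩ := htz_R3 (K := K) (fun m => h (σ.symm m) / h i) (h k / h i)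
    (by simp [hσ0, hi]) (by simp [hσ1, ← heq, hi]) (by simp [hσ2]) (by simp [hσ3, hl])
    (div_ne_zero hk hi) _ _ (fun b l => rfl) (fun b l => rfl)
  exact false_of_witness_perm_scale hκ c hc t hJ v₀ v₀' hv₀ hv₀' hpeel h hh σ (h i) hi _ _
    hy₀h hy₁h hdet htz

/-- Leaf: all coordinates equal and non-zero (pattern R4). [folklore] -/
theorem leaf_four_equal (h0 : h 0 ≠ 0) (e1 : h 1 = h 0) (e2 : h 2 = h 0) (e3 : h 3 = h 0) :
    False := by
  obtain ⟨hy₀h, hy₁h, hdet, htz⟩ := htz_R4 (K := K) (fun m => h ((Equiv.refl (Fin 4)).symm m) / h 0)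
    (by simp [h0]) (by simp [e1, h0]) (by simp [e2, h0]) (by simp [e3, h0]) _ _
    (fun b l => rfl) (fun b l => rfl)
  exact false_of_witness_perm_scale hκ c hc t hJ v₀ v₀' hv₀ hv₀' hpeel h hh (Equiv.refl _) (h 0) h0 _ _
    hy₀h hy₁h hdet htz

/-- Leaf: `h i = h j = h k ≠ 0` and `h l ∉ {0, h i}` (pattern R5). [folklore] -/
theorem leaf_three_one (i j k l : Fin 4) (hij : i ≠ j) (hik : i ≠ k) (hil : i ≠ l) (hjk : j ≠ k)
    (hjl : j ≠ l) (hkl : k ≠ l) (hi : h i ≠ 0) (ej : h j = h i) (ek : h k = h i)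
    (hne : h l ≠ h i) : False := by
  obtain ⟨σ, hσ0, hσ1, hσ2, hσ3⟩ := exists_perm_of_tuple i j k l hij hik hil hjk hjl hkl
  obtain ⟨hy₀h, hy₁h, hdet, htz⟩ := htz_R5 (K := K) (fun m => h (σ.symm m) / h i) (h l / h i)
    (by simp [hσ0, hi]) (by simp [hσ1, ej, hi]) (by simp [hσ2, ek, hi]) (by simp [hσ3])
    (by
      intro e; apply hne
      have : h l / h i = 1 := by linear_combination e
      rwa [div_eq_one_iff_eq hi] at this) _ _ (fun b l => rfl) (fun b l => rfl)
  exact false_of_witness_perm_scale hκ c hc t hJ v₀ v₀' hv₀ hv₀' hpeel h hh σ (h i) hi _ _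
    hy₀h hy₁h hdet htz

/-- Leaf: `h i = h j ≠ 0`, `h k = h l ≠ 0`, `h i ≠ h k` (pattern R6). [folklore] -/
theorem leaf_two_two (i j k l : Fin 4) (hij : i ≠ j) (hik : i ≠ k) (hil : i ≠ l) (hjk : j ≠ k)
    (hjl : j ≠ l) (hkl : k ≠ l) (hi : h i ≠ 0) (ej : h j = h i) (el : h l = h k)
    (hne : h k ≠ h i) : False := by
  obtain ⟨σ, hσ0, hσ1, hσ2, hσ3⟩ := exists_perm_of_tuple i j k l hij hik hil hjk hjl hkl
  obtain ⟨hy₀h, hy₁h, hdet, htz⟩ := htz_R6 (K := K) (fun m => h (σ.symm m) / h i) (h k / h i)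
    (by simp [hσ0, hi]) (by simp [hσ1, ej, hi]) (by simp [hσ2]) (by simp [hσ3, el])
    (by
      intro e; apply hne
      have : h k / h i = 1 := by linear_combination e
      rwa [div_eq_one_iff_eq hi] at this) _ _ (fun b l => rfl) (fun b l => rfl)
  exact false_of_witness_perm_scale hκ c hc t hJ v₀ v₀' hv₀ hv₀' hpeel h hh σ (h i) hi _ _
    hy₀h hy₁h hdet htz

end leaves

section tree

variable [CharZero K] {κ : Type v} [Fintype κ] [DecidableEq κ]
  (hκ : Fintype.card κ = 10) (c : κ → K) (hc : ∀ r, c r ≠ 0)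
  (t : κ → (((Fin 4 → K) × (Fin 4 → K)) →ₗ[K] ((Fin 4 → K) × (Fin 4 → K)) →ₗ[K] K))
  (hJ : ∀ a b y₂ y₃ : Fin 4 → K,
    ∑ r, c r * (t r (a, b) (y₂, y₃)) ^ 2 = (Matrix.of ![a, b, y₂, y₃]).permanent)
  (v₀ v₀' : κ → K) (hv₀ : ∀ (a x : Fin 4 → K), ∃ s : K, (fun r => t r (a, 0) (x, 0)) = s • v₀)
  (hv₀' : ∀ (b x : Fin 4 → K), ∃ s : K, (fun r => t r (0, b) (0, x)) = s • v₀')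
  (hpeel : ∃ a b y z : Fin 4 → K, ∑ r, c r * t r (a, 0) (y, 0) * t r (0, b) (0, z) ≠ 0)
include hκ hc hJ hv₀ hv₀' hpeel

/-- **No peeled reduced family with exactly ten squares** (case tree on the row-`𝟙` coefficients
`h`). [folklore] -/
theorem false_of_peeled_ten (h : Fin 4 → K)
    (hh : ∀ k r, t r ((fun _ => 1), 0) (Pi.single k 1, 0) = h k * v₀ r) : False := by
  by_cases z0 : h 0 = 0 <;> by_cases z1 : h 1 = 0 <;> by_cases z2 : h 2 = 0 <;>
    by_cases z3 : h 3 = 0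
  · -- zeros at [0, 1, 2, 3], non-zero at []
    exact leaf_zero hκ c hc t hJ v₀ v₀' hv₀ hv₀' hpeel h hh (fun k => by fin_cases k <;> assumption)
  · -- zeros at [0, 1, 2], non-zero at [3]
    exact leaf_one hκ c hc t hJ v₀ v₀' hv₀ hv₀' hpeel h hh 3 z3 (fun k hk => by
      fin_cases k <;> first | exact absurd rfl hk | assumption)
  · -- zeros at [0, 1, 3], non-zero at [2]
    exact leaf_one hκ c hc t hJ v₀ v₀' hv₀ hv₀' hpeel h hh 2 z2 (fun k hk => by
      fin_cases k <;> first | exact absurd rfl hk | assumption)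
  · -- zeros at [0, 1], non-zero at [2, 3]
    exact leaf_two hκ c hc t hJ v₀ v₀' hv₀ hv₀' hpeel h hh 2 3 (by decide) z2 z3 (fun k hki hkj => by
      fin_cases k <;> first | exact absurd rfl hki | exact absurd rfl hkj | assumption)
  · -- zeros at [0, 2, 3], non-zero at [1]
    exact leaf_one hκ c hc t hJ v₀ v₀' hv₀ hv₀' hpeel h hh 1 z1 (fun k hk => by
      fin_cases k <;> first | exact absurd rfl hk | assumption)
  · -- zeros at [0, 2], non-zero at [1, 3]
    exact leaf_two hκ c hc t hJ v₀ v₀' hv₀ hv₀' hpeel h hh 1 3 (by decide) z1 z3 (fun k hki hkj => by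
      fin_cases k <;> first | exact absurd rfl hki | exact absurd rfl hkj | assumption)
  · -- zeros at [0, 3], non-zero at [1, 2]
    exact leaf_two hκ c hc t hJ v₀ v₀' hv₀ hv₀' hpeel h hh 1 2 (by decide) z1 z2 (fun k hki hkj => by
      fin_cases k <;> first | exact absurd rfl hki | exact absurd rfl hkj | assumption)
  · -- zeros at [0], non-zero at [1, 2, 3]
    by_cases e12 : h 1 = h 2
    · exact leaf_three hκ c hc t hJ v₀ v₀' hv₀ hv₀' hpeel h hh 1 2 3 0 (by decide) (by decide) (by decide) (by decide) (by decide) (by decide) z1 z3 z0 e12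
    by_cases e13 : h 1 = h 3
    · exact leaf_three hκ c hc t hJ v₀ v₀' hv₀ hv₀' hpeel h hh 1 3 2 0 (by decide) (by decide) (by decide) (by decide) (by decide) (by decide) z1 z2 z0 e13
    by_cases e23 : h 2 = h 3
    · exact leaf_three hκ c hc t hJ v₀ v₀' hv₀ hv₀' hpeel h hh 2 3 1 0 (by decide) (by decide) (by decide) (by decide) (by decide) (by decide) z2 z1 z0 e23
    exact false_of_peeled_ten_of_triple hκ c hc t hJ v₀ v₀' hv₀ hv₀' hpeel h hh 1 2 3 (by decide) (by decide) (by decide)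
      z1 z2 z3 e12 e13 e23
  · -- zeros at [1, 2, 3], non-zero at [0]
    exact leaf_one hκ c hc t hJ v₀ v₀' hv₀ hv₀' hpeel h hh 0 z0 (fun k hk => by
      fin_cases k <;> first | exact absurd rfl hk | assumption)
  · -- zeros at [1, 2], non-zero at [0, 3]
    exact leaf_two hκ c hc t hJ v₀ v₀' hv₀ hv₀' hpeel h hh 0 3 (by decide) z0 z3 (fun k hki hkj => by
      fin_cases k <;> first | exact absurd rfl hki | exact absurd rfl hkj | assumption)
  · -- zeros at [1, 3], non-zero at [0, 2]
    exact leaf_two hκ c hc t hJ v₀ v₀' hv₀ hv₀' hpeel h hh 0 2 (by decide) z0 z2 (fun k hki hkj => by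
      fin_cases k <;> first | exact absurd rfl hki | exact absurd rfl hkj | assumption)
  · -- zeros at [1], non-zero at [0, 2, 3]
    by_cases e02 : h 0 = h 2
    · exact leaf_three hκ c hc t hJ v₀ v₀' hv₀ hv₀' hpeel h hh 0 2 3 1 (by decide) (by decide) (by decide) (by decide) (by decide) (by decide) z0 z3 z1 e02
    by_cases e03 : h 0 = h 3
    · exact leaf_three hκ c hc t hJ v₀ v₀' hv₀ hv₀' hpeel h hh 0 3 2 1 (by decide) (by decide) (by decide) (by decide) (by decide) (by decide) z0 z2 z1 e03
    by_cases e23 : h 2 = h 3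
    · exact leaf_three hκ c hc t hJ v₀ v₀' hv₀ hv₀' hpeel h hh 2 3 0 1 (by decide) (by decide) (by decide) (by decide) (by decide) (by decide) z2 z0 z1 e23
    exact false_of_peeled_ten_of_triple hκ c hc t hJ v₀ v₀' hv₀ hv₀' hpeel h hh 0 2 3 (by decide) (by decide) (by decide)
      z0 z2 z3 e02 e03 e23
  · -- zeros at [2, 3], non-zero at [0, 1]
    exact leaf_two hκ c hc t hJ v₀ v₀' hv₀ hv₀' hpeel h hh 0 1 (by decide) z0 z1 (fun k hki hkj => by
      fin_cases k <;> first | exact absurd rfl hki | exact absurd rfl hkj | assumption)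
  · -- zeros at [2], non-zero at [0, 1, 3]
    by_cases e01 : h 0 = h 1
    · exact leaf_three hκ c hc t hJ v₀ v₀' hv₀ hv₀' hpeel h hh 0 1 3 2 (by decide) (by decide) (by decide) (by decide) (by decide) (by decide) z0 z3 z2 e01
    by_cases e03 : h 0 = h 3
    · exact leaf_three hκ c hc t hJ v₀ v₀' hv₀ hv₀' hpeel h hh 0 3 1 2 (by decide) (by decide) (by decide) (by decide) (by decide) (by decide) z0 z1 z2 e03
    by_cases e13 : h 1 = h 3
    · exact leaf_three hκ c hc t hJ v₀ v₀' hv₀ hv₀' hpeel h hh 1 3 0 2 (by decide) (by decide) (by decide) (by decide) (by decide) (by decide) z1 z0 z2 e13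
    exact false_of_peeled_ten_of_triple hκ c hc t hJ v₀ v₀' hv₀ hv₀' hpeel h hh 0 1 3 (by decide) (by decide) (by decide)
      z0 z1 z3 e01 e03 e13
  · -- zeros at [3], non-zero at [0, 1, 2]
    by_cases e01 : h 0 = h 1
    · exact leaf_three hκ c hc t hJ v₀ v₀' hv₀ hv₀' hpeel h hh 0 1 2 3 (by decide) (by decide) (by decide) (by decide) (by decide) (by decide) z0 z2 z3 e01
    by_cases e02 : h 0 = h 2
    · exact leaf_three hκ c hc t hJ v₀ v₀' hv₀ hv₀' hpeel h hh 0 2 1 3 (by decide) (by decide) (by decide) (by decide) (by decide) (by decide) z0 z1 z3 e02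
    by_cases e12 : h 1 = h 2
    · exact leaf_three hκ c hc t hJ v₀ v₀' hv₀ hv₀' hpeel h hh 1 2 0 3 (by decide) (by decide) (by decide) (by decide) (by decide) (by decide) z1 z0 z3 e12
    exact false_of_peeled_ten_of_triple hκ c hc t hJ v₀ v₀' hv₀ hv₀' hpeel h hh 0 1 2 (by decide) (by decide) (by decide)
      z0 z1 z2 e01 e02 e12
  · -- zeros at [], non-zero at [0, 1, 2, 3]
    by_cases e01 : h 1 = h 0
    · by_cases e02 : h 2 = h 0
      · by_cases e03 : h 3 = h 0
        · exact leaf_four_equal hκ c hc t hJ v₀ v₀' hv₀ hv₀' hpeel h hh z0 e01 e02 e03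
        · exact leaf_three_one hκ c hc t hJ v₀ v₀' hv₀ hv₀' hpeel h hh 0 1 2 3 (by decide) (by decide) (by decide) (by decide) (by decide) (by decide) z0 e01 e02 e03
      · by_cases e03 : h 3 = h 0
        · exact leaf_three_one hκ c hc t hJ v₀ v₀' hv₀ hv₀' hpeel h hh 0 1 3 2 (by decide) (by decide) (by decide) (by decide) (by decide) (by decide) z0 e01 e03 e02
        · by_cases e23 : h 3 = h 2
          · exact leaf_two_two hκ c hc t hJ v₀ v₀' hv₀ hv₀' hpeel h hh 0 1 2 3 (by decide) (by decide) (by decide) (by decide) (by decide) (by decide) z0 e01 e23 e02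
          · exact false_of_peeled_ten_of_triple hκ c hc t hJ v₀ v₀' hv₀ hv₀' hpeel h hh 0 2 3 (by decide) (by decide) (by decide)
              z0 z2 z3 (Ne.symm e02) (Ne.symm e03) (Ne.symm e23)
    · by_cases e02 : h 2 = h 0
      · by_cases e03 : h 3 = h 0
        · exact leaf_three_one hκ c hc t hJ v₀ v₀' hv₀ hv₀' hpeel h hh 0 2 3 1 (by decide) (by decide) (by decide) (by decide) (by decide) (by decide) z0 e02 e03 e01
        · by_cases e13 : h 3 = h 1
          · exact leaf_two_two hκ c hc t hJ v₀ v₀' hv₀ hv₀' hpeel h hh 0 2 1 3 (by decide) (by decide) (by decide) (by decide) (by decide) (by decide) z0 e02 e13 e01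
          · exact false_of_peeled_ten_of_triple hκ c hc t hJ v₀ v₀' hv₀ hv₀' hpeel h hh 0 1 3 (by decide) (by decide) (by decide)
              z0 z1 z3 (Ne.symm e01) (Ne.symm e03) (Ne.symm e13)
      · by_cases e12 : h 2 = h 1
        · by_cases e03 : h 3 = h 0
          · exact leaf_two_two hκ c hc t hJ v₀ v₀' hv₀ hv₀' hpeel h hh 0 3 1 2 (by decide) (by decide) (by decide) (by decide) (by decide) (by decide) z0 e03 e12 e01
          · by_cases e13 : h 3 = h 1
            · exact leaf_three_one hκ c hc t hJ v₀ v₀' hv₀ hv₀' hpeel h hh 1 2 3 0 (by decide) (by decide) (by decide) (by decide) (by decide) (by decide) z1 e12 e13 (Ne.symm e01)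
            · exact false_of_peeled_ten_of_triple hκ c hc t hJ v₀ v₀' hv₀ hv₀' hpeel h hh 0 1 3 (by decide) (by decide) (by decide)
                z0 z1 z3 (Ne.symm e01) (Ne.symm e03) (Ne.symm e13)
        · exact false_of_peeled_ten_of_triple hκ c hc t hJ v₀ v₀' hv₀ hv₀' hpeel h hh 0 1 2 (by decide) (by decide) (by decide)
            z0 z1 z2 (Ne.symm e01) (Ne.symm e02) (Ne.symm e12)

end tree

/-- **No peeled reduced family with at most ten squares.**  See the module docstring.
[folklore] -/
theorem false_of_peeled_le_ten [CharZero K] {κ : Type v} [Fintype κ] [DecidableEq κ]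
    (hκ : Fintype.card κ ≤ 10) (c : κ → K) (hc : ∀ r, c r ≠ 0)
    (t : κ → (((Fin 4 → K) × (Fin 4 → K)) →ₗ[K] ((Fin 4 → K) × (Fin 4 → K)) →ₗ[K] K))
    (hJ : ∀ a b y₂ y₃ : Fin 4 → K,
      ∑ r, c r * (t r (a, b) (y₂, y₃)) ^ 2 = (Matrix.of ![a, b, y₂, y₃]).permanent)
    (v₀ v₀' : κ → K) (hv₀ : ∀ (a x : Fin 4 → K), ∃ s : K, (fun r => t r (a, 0) (x, 0)) = s • v₀)
    (hv₀' : ∀ (b x : Fin 4 → K), ∃ s : K, (fun r => t r (0, b) (0, x)) = s • v₀')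
    (hpeel : ∃ a b y z : Fin 4 → K, ∑ r, c r * t r (a, 0) (y, 0) * t r (0, b) (0, z) ≠ 0) :
    False := by
  classical
  -- the row-`𝟙` coefficients of the scalar `a`-block
  choose S hS using hv₀
  have hh : ∀ k r, t r ((fun _ => 1), 0) (Pi.single k 1, 0) = S (fun _ => 1) (Pi.single k 1) * v₀ r :=
    fun k r => by have := congr_fun (hS (fun _ => 1) (Pi.single k 1)) r; simpa using this
  obtain ⟨κ', _, _, c', t', w₀, w₀', hκ', hc', hJ', hw₀, hw₀', hpeel', hh'⟩ :=
    pad_to_ten hκ c hc t hJ v₀ v₀' (fun a x => ⟨S a x, hS a x⟩) hv₀' hpeel _ hh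
  exact false_of_peeled_ten hκ' c' hc' t' hJ' w₀ w₀' hw₀ hw₀' hpeel' _ hh'

end Summit.ValiantsHypothesis.ValiantsHypothesis.Theorems.SymPencilPerFourPeeledTen

end
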